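import Summits.ABC.StewartYu.PadicG3HalfSeparation
import HarnessLib

/-!
# Cell abc-stewartyu, WP-L.P(odd) (crux r3 `PadicCoreOddRat`, stmt-ABC-20503): SEPARATION at a half point with a COMMON RATIONAL `p`-UNIT
# FACTOR pulled out of the class sums (the saturated frame clears only the SIGNED floor part of the root monomials)

`Summits/ABC/StewartYu/PadicG3SatHalfSeparation.lean` — cell `abc-stewartyu` (HOME `run/shared/lean/pub/abc-stewartyu/`, design memo
HOME/p2/memo-07-WPLP-odd-Nframe-design.md §2 row «half-step algebra»; seat p2-g6).  One theorem on `G3Setup`; no named fact, no parameters.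

Twin of `PadicG3HalfSeparation.classSums_eq_zero_of_norm_g3Φ_half_lt` (landed, p2-g4): there the class sums carry the rational parts
`qEhG S.α (eᵢ)` of the natural root exponents `eᵢ = rootExp L vᵢ s = vᵢ s + 2L|s|`, whose common factor `∏ θⱼ^{Lⱼ|s|}` the record had to clear
and bound (affordable in α-coordinates, NOT in the θ-coordinates of the saturated frame: memo §0 third dead design).  Here the class sums are
formed with ABSTRACT rational parts `g i` such that `qEhG S.α (e i) = Q · g i` for one rational `Q` with `‖Q‖_p = 1` (the saturated frame takes
`g i = ∏ θⱼ^{⌊vᵢⱼ s/2⌋}`, `Q = ∏ θⱼ^{Lⱼ|s|}`, `PadicG3HalfRebase.qEhG_rootExp_of_shift`), and the record's denominator `D`, total size `Mb` and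
inequality refer to the SCALED sums only:

* **`classSums_eq_zero_of_norm_g3Φ_half_lt_scaled`** — `‖φ_τ(s/2)‖_p < D/(4D²·Mb·(∏H(θⱼ))³)^{2^{n+1}}` ⇒ both scaled class-sum vectors vanish.

WHAT THIS IS NOT: no descent (that is `PadicG3SatLevelStepH`); no crux moves.

References: K. Yu, Compositio 74 (1990) Lemma 2.5; M. Waldschmidt, Acta Arith. 37 (1980) Lemma 3.7; Yu. V. Nesterenko, LNM 1819 (2003) §4.3.
-/

noncomputable section

open NormedSpace Finset Polynomial IsUltrametricDist
open Literature.NumberTheory.Transcendental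
open Literature.NumberTheory.Transcendental.CW77.Setup (Tau tauNorm)
open scoped Nat

namespace Summit.ABC.StewartYu

namespace G3Setup

variable {p : ℕ} [Fact p.Prime] (S : G3Setup p) {ι : Type*} (R : ι → ℚ[X]) (v : ι → Fin S.n → ℤ)

/-- A fibre sum of scaled terms is the scaled fibre sum: `Σ_{fibre} wᵢ·(cᵢ·(Q·gᵢ)) = Q · Σ_{fibre} wᵢ·(cᵢ·gᵢ)`. [folklore] -/
theorem classSum_scaled (B' : Finset ι) (w c g : ι → ℚ) (Q : ℚ) :
    ∑ i ∈ B', w i * (c i * (Q * g i)) = Q * ∑ i ∈ B', w i * (c i * g i) := by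
  rw [mul_sum]; exact sum_congr rfl fun i _ => by ring

/-- **Separation at a half point with a common rational `p`-unit factor (any odd `p`, generic family).**  Setting of
`PadicG3HalfSplit.g3Φ_half_complex_split` (common unit `U`, natural root exponents `e i` in one exponent class, root data `sq_j = ŝ_j ξ^{r_j}`,
`ŝ_j² = θ_j`, `‖ŝ_j‖ ≤ 1`, `ξ^M = ι`, `ι² = −1`, `‖ξ‖ = 1`), signed Kummer condition on the generators, and rational parts
`qEhG θ (e i) = Q · g i` with `‖Q‖_p = 1`: if the SCALED class-sum vectors `C′₀` (even `kᵢ`), `C′₁` (odd `kᵢ`), formed with `g i`, satisfy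
`D·C′_b ∈ ℤ`, `Σ|C′₀| + Σ|C′₁| ≤ Mb` and `‖φ_τ(s/2)‖_p < D/(4D²Mb(∏H(θⱼ))³)^{2^{n+1}}`, then `C′₀ = 0` and `C′₁ = 0`.
[cite: Yu1990, Lemma 2.5] [cite: Waldschmidt1980, Lemma 3.7] -/
theorem classSums_eq_zero_of_norm_g3Φ_half_lt_scaled (B : Finset ι) (pv : ι → ℤ) (τ : Tau S.n) (s : ℤ) (U : ℚ_[p]) (hU : ‖U‖ = 1)
    (e : ι → Fin S.n → ℕ) (he : ∀ i ∈ B, ∏ j, S.sq j ^ (v i j * s) = U * ∏ j, S.sq j ^ e i j)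
    (ŝ : Fin S.n → ℂ_[p]) (ξ ιC : ℂ_[p]) (r : Fin S.n → ℕ) {M c₀ : ℕ} (k : ι → ℕ)
    (hσ : ∀ j, algebraMap ℚ_[p] ℂ_[p] (S.sq j) = ŝ j * ξ ^ r j)
    (hι : ξ ^ M = ιC) (hι2 : ιC ^ 2 = -1) (hξ : ‖ξ‖ = 1)
    (hcls : ∀ i ∈ B, ∑ j, r j * e i j = c₀ + k i * M)
    (hŝ : ∀ j, ŝ j * ŝ j = (S.α j : ℂ_[p])) (hŝ1 : ∀ j, ‖ŝ j‖ ≤ 1)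
    (hind : ∀ T : Finset (Fin S.n), T.Nonempty → ¬ IsSquare (∏ j ∈ T, S.α j) ∧ ¬ IsSquare (-∏ j ∈ T, S.α j))
    (Q : ℚ) (hQ : ‖(Q : ℚ_[p])‖ = 1) (g : ι → ℚ) (hg : ∀ i ∈ B, HalfMono.qEhG S.α (e i) = Q * g i)
    {D : ℕ} (hD : 1 ≤ D) {Mb : ℝ} (hMb : 1 ≤ Mb)
    (hden₀ : ∀ T', ∃ z : ℤ, (D : ℚ) * (∑ i ∈ (B.filter (fun i => Even (k i))) with HalfMono.SsetG (e i) = T',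
        (((-1) ^ (k i / 2) * pv i : ℤ) : ℚ) *
          (((hasseDeriv τ.1 (R i)).eval ((s : ℚ) / 2) * S.zγpow v i τ.2) * g i)) = z)
    (hden₁ : ∀ T', ∃ z : ℤ, (D : ℚ) * (∑ i ∈ (B.filter (fun i => ¬ Even (k i))) with HalfMono.SsetG (e i) = T',
        (((-1) ^ (k i / 2) * pv i : ℤ) : ℚ) *
          (((hasseDeriv τ.1 (R i)).eval ((s : ℚ) / 2) * S.zγpow v i τ.2) * g i)) = z)
    (hcM : ∑ T', |((∑ i ∈ (B.filter (fun i => Even (k i))) with HalfMono.SsetG (e i) = T',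
        (((-1) ^ (k i / 2) * pv i : ℤ) : ℚ) *
          (((hasseDeriv τ.1 (R i)).eval ((s : ℚ) / 2) * S.zγpow v i τ.2) * g i) : ℚ) : ℝ)| +
      ∑ T', |((∑ i ∈ (B.filter (fun i => ¬ Even (k i))) with HalfMono.SsetG (e i) = T',
        (((-1) ^ (k i / 2) * pv i : ℤ) : ℚ) *
          (((hasseDeriv τ.1 (R i)).eval ((s : ℚ) / 2) * S.zγpow v i τ.2) * g i) : ℚ) : ℝ)| ≤ Mb)
    (hlt : ‖S.g3Φ R v B pv τ ((2 : ℚ_[p])⁻¹ * (s : ℚ_[p]))‖ <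
      (D : ℝ) / (4 * (D : ℝ) ^ 2 * Mb * CW77.heightProd S.α ^ 3) ^ (2 ^ (S.n + 1))) :
    (fun T' => ∑ i ∈ (B.filter (fun i => Even (k i))) with HalfMono.SsetG (e i) = T',
        (((-1) ^ (k i / 2) * pv i : ℤ) : ℚ) *
          (((hasseDeriv τ.1 (R i)).eval ((s : ℚ) / 2) * S.zγpow v i τ.2) * g i)) = 0 ∧
    (fun T' => ∑ i ∈ (B.filter (fun i => ¬ Even (k i))) with HalfMono.SsetG (e i) = T',
        (((-1) ^ (k i / 2) * pv i : ℤ) : ℚ) *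
          (((hasseDeriv τ.1 (R i)).eval ((s : ℚ) / 2) * S.zγpow v i τ.2) * g i)) = 0 := by
  classical
  -- the scaled class sums `C′_b` and the full ones `C_b = Q • C′_b`
  set C₀ : Finset (Fin S.n) → ℚ := fun T' =>
    ∑ i ∈ (B.filter (fun i => Even (k i))) with HalfMono.SsetG (e i) = T',
      (((-1) ^ (k i / 2) * pv i : ℤ) : ℚ) *
        (((hasseDeriv τ.1 (R i)).eval ((s : ℚ) / 2) * S.zγpow v i τ.2) * g i) with hC₀
  set C₁ : Finset (Fin S.n) → ℚ := fun T' =>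
    ∑ i ∈ (B.filter (fun i => ¬ Even (k i))) with HalfMono.SsetG (e i) = T',
      (((-1) ^ (k i / 2) * pv i : ℤ) : ℚ) *
        (((hasseDeriv τ.1 (R i)).eval ((s : ℚ) / 2) * S.zγpow v i τ.2) * g i) with hC₁
  by_contra hne
  have hfull₀ : (fun T' => ∑ i ∈ (B.filter (fun i => Even (k i))) with HalfMono.SsetG (e i) = T',
      (((-1) ^ (k i / 2) * pv i : ℤ) : ℚ) *
        (((hasseDeriv τ.1 (R i)).eval ((s : ℚ) / 2) * S.zγpow v i τ.2) * HalfMono.qEhG S.α (e i))) = Q • C₀ := by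
    funext T'
    simp only [hC₀, Pi.smul_apply, smul_eq_mul]
    rw [← classSum_scaled]
    refine sum_congr rfl fun i hi => ?_
    rw [hg i (mem_filter.mp (mem_filter.mp hi).1).1]
  have hfull₁ : (fun T' => ∑ i ∈ (B.filter (fun i => ¬ Even (k i))) with HalfMono.SsetG (e i) = T',
      (((-1) ^ (k i / 2) * pv i : ℤ) : ℚ) *
        (((hasseDeriv τ.1 (R i)).eval ((s : ℚ) / 2) * S.zγpow v i τ.2) * HalfMono.qEhG S.α (e i))) = Q • C₁ := by
    funext T'
    simp only [hC₁, Pi.smul_apply, smul_eq_mul]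
    rw [← classSum_scaled]
    refine sum_congr rfl fun i hi => ?_
    rw [hg i (mem_filter.mp (mem_filter.mp hi).1).1]
  -- the value in `ℂ_p`
  have hval : algebraMap ℚ_[p] ℂ_[p] (S.g3Φ R v B pv τ ((2 : ℚ_[p])⁻¹ * (s : ℚ_[p]))) =
      algebraMap ℚ_[p] ℂ_[p] U * (ξ ^ c₀ * ((Q : ℂ_[p]) * (Multiquad.evL ŝ C₀ + ιC * Multiquad.evL ŝ C₁))) := by
    rw [S.g3Φ_half_complex_split R v B pv τ s U e he ŝ ξ ιC r k hσ hι hι2 hcls,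
      S.half_sum_eq_evL R v _ pv τ s e ŝ hŝ k, S.half_sum_eq_evL R v _ pv τ s e ŝ hŝ k, hfull₀, hfull₁,
      Multiquad.evL_smul, Multiquad.evL_smul]
    ring
  -- norms: `‖φ(s/2)‖_p = ‖evL ŝ C′₀ + ι evL ŝ C′₁‖`
  have hUn : ‖algebraMap ℚ_[p] ℂ_[p] U‖ = 1 := by
    rw [show algebraMap ℚ_[p] ℂ_[p] U = ((U : ℚ_[p]) : ℂ_[p]) from rfl, PadicComplex.norm_extends', hU]
  have hQn : ‖(Q : ℂ_[p])‖ = 1 := by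
    rw [← map_ratCast (algebraMap ℚ_[p] ℂ_[p]) Q, show algebraMap ℚ_[p] ℂ_[p] (Q : ℚ_[p]) = (((Q : ℚ_[p])) : ℂ_[p]) from rfl,
      PadicComplex.norm_extends', hQ]
  have hnorm : ‖S.g3Φ R v B pv τ ((2 : ℚ_[p])⁻¹ * (s : ℚ_[p]))‖ = ‖Multiquad.evL ŝ C₀ + ιC * Multiquad.evL ŝ C₁‖ := by
    rw [← PadicComplex.norm_extends', show ((S.g3Φ R v B pv τ ((2 : ℚ_[p])⁻¹ * (s : ℚ_[p])) : ℚ_[p]) : ℂ_[p]) =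
      algebraMap ℚ_[p] ℂ_[p] (S.g3Φ R v B pv τ ((2 : ℚ_[p])⁻¹ * (s : ℚ_[p]))) from rfl, hval,
      norm_mul, norm_mul, norm_mul, norm_pow, hUn, hξ, hQn, one_pow, one_mul, one_mul, one_mul]
  -- Liouville in `ℂ_p`
  have hιmul : ιC * ιC = -1 := by rw [← pow_two]; exact hι2
  have key := TwistHalf.norm_evL_add_iota_mul_ge
    (L := ℂ_[p]) (fun z => Literature.NumberTheory.LFunctions.Dwork.norm_intCast_le_one p z)
    (fun n hn => PadicComplexFacts.inv_natCast_le_norm_natCast hn) S.α hind ŝ hŝ hŝ1 ιC hιmul C₀ C₁ hne D hD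
    hden₀ hden₁ Mb hMb hcM
  rw [hnorm] at hlt
  exact absurd (lt_of_le_of_lt key hlt) (lt_irrefl _)

end G3Setup

end Summit.ABC.StewartYu

end
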